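import Literature.RepresentationTheory.ModularTensorCategories.KLRecoupling

/-!
# The Kauffman–Lins pentagon in the F-move arrangement

Topic `Literature/RepresentationTheory/ModularTensorCategories` (definition item `defn-ModularDatum`; step 1
of the transport of `KLPentagon` to the unitary `SU(2)_k` F-symbols).

* `thetaNet_comm`, `tetNet_swap`, `sixjKL_swap` — the symmetry `{x y i; z w j} = {z w i; x y j}` of the
  Kauffman–Lins q-6j symbol, PROVED from the printed closed formulas (θ symmetric; the `aᵢ`, `bⱼ` of
  `Tet` are permuted: `a₁ ↔ a₂`, `a₃ ↔ a₄`).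
* `sixjKL_pentagon_F` — from the printed pentagon `KLPentagon k` (KL §9.14 with the dictionary
  `a := c, i := g, m := h, d := a, e := b, j := f, b := d, c := e, l := k', k := l` and three uses of
  `sixjKL_swap`), the pentagon identity in the index arrangement of `PreModularDatum.pentagon` for
  `G a b c d e f := {a b f; c d e}`:
  `G^{fcd}_{e;gl} G^{abl}_{e;fk} = Σ_h G^{abc}_{g;fh} G^{ahd}_{e;gk} G^{bcd}_{k;hl}`.
Remaining for the pentagon of `fSym` (sibling, not here): the normalisation identity
`fSym a b c d e f = {a b f; c d e} · √(|Δ_e θ(b,c,f) θ(a,f,d)| / |Δ_f θ(a,b,e) θ(e,c,d)|)` and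
`pentagon_iff_of_gauge` (`Gauge.lean`).
-/

noncomputable section

open Finset

namespace Literature.RepresentationTheory.ModularTensorCategories.SU2LevelK

variable (k : ℕ)

/-- `θ(a,b,c) = θ(b,a,c)` (the θ-net formula is symmetric in `m, n, p`). [cite: KauffmanLins1994, §9.10 (i)] -/
theorem thetaNet_comm (a b c : ℕ) : thetaNet k a b c = thetaNet k b a c := by
  unfold thetaNet
  simp only
  rw [Nat.add_comm b a]
  generalize (a + b - c) / 2 = m
  generalize (b + c - a) / 2 = n
  generalize (a + c - b) / 2 = p
  rw [show m + p + n = m + n + p by omega, Nat.add_comm p n, Nat.add_comm n m, Nat.add_comm m p]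
  ring

/-- `Tet[x y i; z w j] = Tet[z w i; x y j]` (the `aᵢ` and `bⱼ` of the closed formula are permuted).
[cite: KauffmanLins1994, §9.11] -/
theorem tetNet_swap (x y i z w j : ℕ) : tetNet k z w i x y j = tetNet k x y i z w j := by
  unfold tetNet
  simp only
  have e1 : (z + y + i) / 2 = (y + z + i) / 2 := by rw [Nat.add_comm z y]
  have e2 : (w + x + i) / 2 = (x + w + i) / 2 := by rw [Nat.add_comm w x]
  have e3 : (w + y + i + j) / 2 = (y + w + i + j) / 2 := by rw [Nat.add_comm w y]
  have e4 : (z + x + i + j) / 2 = (x + z + i + j) / 2 := by rw [Nat.add_comm z x]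
  have e5 : (z + w + x + y) / 2 = (x + y + z + w) / 2 := by
    rw [show z + w + x + y = x + y + z + w by omega]
  rw [e1, e2, e3, e4, e5]
  generalize (x + w + i) / 2 = a₁
  generalize (y + z + i) / 2 = a₂
  generalize (x + y + j) / 2 = a₃
  generalize (z + w + j) / 2 = a₄
  generalize (y + w + i + j) / 2 = b₁
  generalize (x + z + i + j) / 2 = b₂
  generalize (x + y + z + w) / 2 = b₃
  rw [max_comm a₂ a₁, max_comm a₄ a₃]
  congr 1
  · ring
  · refine Finset.sum_congr rfl (fun s _ => ?_)
    ring

/-- The symmetry `{z w i; x y j} = {x y i; z w j}` of the Kauffman–Lins q-6j symbol (rotation of the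
recoupling diagram by π), proved from the closed formulas. [cite: KauffmanLins1994, §9.12 with §9.10–9.11] -/
theorem sixjKL_swap (x y i z w j : ℕ) : sixjKL k z w i x y j = sixjKL k x y i z w j := by
  unfold sixjKL
  have hiff : (Adm k z y i ∧ Adm k w x i ∧ Adm k z w j ∧ Adm k x y j) ↔
      (Adm k x w i ∧ Adm k y z i ∧ Adm k x y j ∧ Adm k z w j) := by
    rw [show Adm k z y i ↔ Adm k y z i from adm_comm k, show Adm k w x i ↔ Adm k x w i from adm_comm k]
    tauto
  by_cases h : Adm k x w i ∧ Adm k y z i ∧ Adm k x y j ∧ Adm k z w j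
  · rw [if_pos (hiff.mpr h), if_pos h, tetNet_swap, thetaNet_comm k z y i, thetaNet_comm k w x i, mul_comm (thetaNet k y z i)]
  · rw [if_neg (fun h' => h (hiff.mp h')), if_neg h]

/-- **The Kauffman–Lins pentagon in the F-move arrangement**: for `G a b c d e f := {a b f; c d e}`,
`G^{fcd}_{e;gl} G^{abl}_{e;fk} = Σ_h G^{abc}_{g;fh} G^{ahd}_{e;gk} G^{bcd}_{k;hl}` — an instance of
`KLPentagon k` (dictionary in the module docstring) after three uses of `sixjKL_swap`.
[cite: KauffmanLins1994, §7.3 Prop. 10 = §9.14 (Biedenharn–Elliott)] -/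
theorem sixjKL_pentagon_F (hKL : KLPentagon k) (a b c d e f g k' l : Fin (k + 1)) :
    sixjKL k f c l d e g * sixjKL k a b k' l e f =
      ∑ h : Fin (k + 1), sixjKL k a b h c g f * sixjKL k a h k' d e g * sixjKL k b c l d k' h := by
  have hle : ∀ z : Fin (k + 1), (z : ℕ) ≤ k := fun z => Nat.lt_succ_iff.mp z.isLt
  -- KL with a := c, i := g, d := a, e := b, j := f, b := d, c := e, l := k', k := l
  have h := hKL c d e a b g f l k' (hle c) (hle d) (hle e) (hle a) (hle b) (hle g) (hle f) (hle l) (hle k')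
  -- h : Σ_m {c g m; a b f}{d e k'; a m g}{d k' l; b c m} = {d e l; f c g}{l e k'; a b f}
  rw [sixjKL_swap k f c l d e g, sixjKL_swap k a b k' l e f] at h
  rw [← h, ← Fin.sum_univ_eq_sum_range (fun m => sixjKL k c g m a b f * sixjKL k d e k' a m g *
    sixjKL k d k' l b c m) (k + 1)]
  refine Finset.sum_congr rfl (fun m _ => ?_)
  rw [sixjKL_swap k a b m c g f, sixjKL_swap k a m k' d e g, sixjKL_swap k b c l d k' m]

end Literature.RepresentationTheory.ModularTensorCategories.SU2LevelK
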